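import Literature.Claims.NS.Akysh2020
import Summits.NavierStokesRegularity.NavierStokesRegularity.Theorems.SoloRefuteKyritsis2022
import HarnessLib

/-!
# C71 `Akysh2020` — kernel facts for the NS-claims sweep (D-0090), refuter-8

Typed record: `Literature.Claims.NS.Akysh2020` (typist-12, p478995), A. Sh. Akysh, *The Cauchy problem
for the Navier–Stokes equations*, Bull. Karaganda Univ. Math. 2020 no. 2(98), 15–23: the premise
`P = −|U|²` (p.15, from Akysh 2018 (5)–(7) p.9) and the passage (4) ⇒ (5) p.16 («We multiply the
equation (4) by the vector function U ≠ 0, then, taking into account the property [rotU, U] ⊥ U we get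
(5)»).

Kernel facts (sorry-free, standard axioms):

* `not_Step_S1Abs` — the sentence's own grain: `a = −w + f`, `w ⊥ U`, `U ≠ 0` does not give `a = f`
  (`U = e₀`, `w = e₁`, `f = 0`).
* `not_Step_S1` — PDE grain: the steady shear `U(t,x) = (x₁, 0, 0)` solves the reduced system (1a)
  with the force it defines (`f :=` the left side of (1a)), is divergence free and smooth, and violates
  (5) at `x = e₁`: there `(U·∇)U = 0` while `∇E = ∇(½x₁²) = e₁ ≠ 0`.
* `not_Step_S0` — the premise: the rest state `u ≡ 0` with constant pressure `p ≡ 1` is a classical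
  Navier–Stokes solution (tree vocabulary, `ν = 1`, zero force, all times) with neither `p = −|u|²` nor
  `p = 0`.

Uses the linear-field toolkit (`lin`, `bv`, `divergence_lin`) of `SoloRefuteKyritsis2022`.

WHAT THIS IS NOT: not a claim about NS regularity or blow-up; not a claim about any author beyond the
typed locator.
-/

set_option linter.dupNamespace false

noncomputable section

open Set Function InnerProductSpace
open scoped ContDiff RealInnerProductSpace Laplacian
open Literature.Analysis.FluidPDE
open Literature.Claims.NS.Akysh2020 (E3 kinE IsReducedSolutionOn)
open Summit.NavierStokesRegularity.NavierStokesRegularity.Theorems.Kyritsis2022 (lin bv pr lin_apply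
  bv_apply norm_bv inner_bv_right divergence_lin)

namespace Summit.NavierStokesRegularity.NavierStokesRegularity.Theorems.Akysh2020

/-! ## (4) ⇒ (5) p.16, the sentence's own grain -/

/-- **(4) ⇒ (5) p.16 is false at its own grain (C71).** `U = e₀ ≠ 0`, `w = e₁ ⊥ U`, `f = 0`,
`a = −w`: the hypotheses hold and `a ≠ f`. Refutes `Literature.Claims.NS.Akysh2020.Step_S1Abs`
[refuted-substantive: orthogonality of the deleted vector to `U` does not delete it from a vector
equation]. [folklore] -/
theorem not_Step_S1Abs : ¬ Literature.Claims.NS.Akysh2020.Step_S1Abs := by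
  intro h
  have key := h (-bv 1) (bv 1) 0 (bv 0)
    (by
      intro h0
      have := congrArg (fun v : E3 => v 0) h0
      simp at this)
    (by simp) (by rw [inner_bv_right]; simp)
  have := congrArg (fun v : E3 => v 1) key
  simp at this

/-! ## (4) ⇒ (5) p.16, PDE grain: the steady shear `(x₁, 0, 0)` -/

/-- Jacobian table of the shear `(x₁, 0, 0)`: the only nonzero entry is `∂U₀/∂x₁ = 1`. -/
def shearM : Fin 3 → Fin 3 → ℝ := ![![0, 1, 0], ![0, 0, 0], ![0, 0, 0]]

/-- The steady shear (plane Couette profile) `U(t,x) = (x₁, 0, 0)`. -/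
def couette (_t : ℝ) (y : E3) : E3 := lin shearM y

/-- Components of the shear: `U(t,x) = (x₁, 0, 0)`. -/
@[simp] theorem couette_apply (t : ℝ) (y : E3) (i : Fin 3) :
    couette t y i = if i = 0 then y 1 else 0 := by
  fin_cases i <;> simp [couette, shearM]

/-- The force slot of (1a) DEFINED as the left side of (1a) along the shear (the force slot of
`IsReducedSolutionOn` is unrestricted). -/
def shearForce (μ : ℝ) (t : ℝ) (x : E3) : E3 :=
  timeDerivWithin univ couette t x - μ • (Δ (couette t)) x + convect (couette t) (couette t) x
    - (2 : ℝ) • gradient (kinE couette t) x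

/-- The shear solves the reduced system (1a) on all times with the force `shearForce μ`. [folklore] -/
theorem isReducedSolutionOn_couette (μ : ℝ) :
    IsReducedSolutionOn univ μ (shearForce μ) couette where
  smooth := by
    unfold IsSmoothSpaceTimeOn
    have e : uncurry couette = fun q : ℝ × E3 => lin shearM q.2 := by
      funext q; rfl
    rw [e]
    exact ((lin shearM).contDiff.comp contDiff_snd).contDiffOn
  eqn := fun _ _ _ => rfl
  divFree := by
    intro t _ x
    show VectorCalculus.divergence (fun z => lin shearM z) x = 0
    rw [divergence_lin]
    simp [shearM]

/-- `(U·∇)U = 0` for the shear. [folklore] -/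
theorem convect_couette (t : ℝ) (x : E3) : convect (couette t) (couette t) x = 0 := by
  have e : couette t = fun z => lin shearM z := rfl
  rw [convect_apply, e, (lin shearM).fderiv]
  ext i
  fin_cases i <;> simp [shearM]

/-- The Jacobian of the shear maps `e₁ ↦ e₀`. [folklore] -/
@[simp] theorem lin_shearM_bv_one : lin shearM (bv 1) = bv 0 := by
  ext i
  fin_cases i <;> simp [shearM]

/-- The `e₁`-component of `∇E`, `E = ½|U|² = ½x₁²`, at `x = e₁` equals `1`. [folklore] -/
theorem gradient_kinE_couette_one (t : ℝ) : gradient (kinE couette t) (bv 1) 1 = 1 := by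
  have hk : HasFDerivAt (kinE couette t)
      ((1 / 2 : ℝ) • ((2 : ℕ) • (innerSL ℝ (lin shearM (bv 1))).comp (lin shearM))) (bv 1) := by
    have h := ((lin shearM).hasFDerivAt (x := bv 1)).norm_sq.const_smul (1 / 2 : ℝ)
    refine h.congr_of_eventuallyEq (Filter.Eventually.of_forall fun y => ?_)
    simp [kinE, couette, smul_eq_mul]
  rw [← inner_bv_right (gradient (kinE couette t) (bv 1)) 1, gradient, toDual_symm_apply, hk.fderiv]
  simp

/-- **(4) ⇒ (5) p.16 is false at the PDE grain (C71).** Along the shear, (1a) − (5) reads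
`(U·∇)U − ∇E = 0`; at `x = e₁` the `e₁`-component of the left side is `0 − 1`. Refutes
`Literature.Claims.NS.Akysh2020.Step_S1` [refuted-substantive: a solution of (1a) need not satisfy (5);
the deleted Lamb vector `[rotU, U] = (0, −x₁, 0)` is not zero]. [folklore] -/
theorem not_Step_S1 : ¬ Literature.Claims.NS.Akysh2020.Step_S1 := by
  intro h
  have h5 := h univ 0 (shearForce 0) couette (isReducedSolutionOn_couette 0) 0 (mem_univ _) (bv 1)
  unfold shearForce at h5
  rw [convect_couette, add_zero] at h5
  -- h5 : T - G = T - 2 • G, hence G = 0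
  have hG : gradient (kinE couette 0) (bv 1) = 0 := by
    have e : (timeDerivWithin univ couette 0 (bv 1) - (0 : ℝ) • (Δ (couette 0)) (bv 1)
        - (2 : ℝ) • gradient (kinE couette 0) (bv 1))
        - (timeDerivWithin univ couette 0 (bv 1) - (0 : ℝ) • (Δ (couette 0)) (bv 1)
        - gradient (kinE couette 0) (bv 1)) = 0 := by
      rw [← h5, sub_self]
    rw [two_smul] at e
    have e' : -gradient (kinE couette 0) (bv 1) = 0 := by
      rw [← e]; abel
    exact neg_eq_zero.mp e'
  have := gradient_kinE_couette_one 0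
  rw [hG] at this
  simp at this

/-! ## The premise p.15 -/

/-- **The premise `P = −|U|² ∨ P = 0` (p.15; Akysh 2018 (7) p.9) is false for Navier–Stokes
solutions (C71).** The rest state `u ≡ 0`, `p ≡ 1` is a classical solution of the unforced system
on all times (every term of the momentum equation vanishes), and `1 ≠ −|0|²`, `1 ≠ 0`. Refutes
`Literature.Claims.NS.Akysh2020.Step_S0` [refuted-substantive at the typed grain; pressure-gauge
witness — any explicit flow with `p ∉ {−|u|², 0}`, e.g. rigid rotation with `p = ½|u|²`, serves as
well]. [folklore] -/
theorem not_Step_S0 : ¬ Literature.Claims.NS.Akysh2020.Step_S0 := by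
  intro h
  have hsol : IsClassicalNSSolutionOn univ 1 0 (fun (_ : ℝ) (_ : E3) => (0 : E3))
      (fun (_ : ℝ) (_ : E3) => (1 : ℝ)) :=
    { smooth_velocity := by
        unfold IsSmoothSpaceTimeOn
        exact contDiffOn_const
      smooth_pressure := by
        unfold IsSmoothSpaceTimeOn
        exact contDiffOn_const
      momentum := by
        intro t _ x
        have h1 : timeDerivWithin univ (fun (_ : ℝ) (_ : E3) => (0 : E3)) t x = 0 := by
          simp [timeDerivWithin]
        have h2 : gradient (fun _ : E3 => (1 : ℝ)) x = 0 := gradient_fun_const x 1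
        rw [h1, h2]
        simp
      divFree := by
        intro t _ x
        simp [VectorCalculus.divergence] }
  rcases h univ 1 _ _ hsol with h1 | h2
  · have := h1 0 (mem_univ _) 0
    simp at this
  · have := h2 0 (mem_univ _) 0
    simp at this

end Summit.NavierStokesRegularity.NavierStokesRegularity.Theorems.Akysh2020

end
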